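import Mathlib.Analysis.SpecialFunctions.Integrals.Basic
import Mathlib.Analysis.SpecialFunctions.Pow.Deriv
import Mathlib.Analysis.Normed.Group.InfiniteSum
import Mathlib.Topology.Algebra.InfiniteSum.ENNReal
import Mathlib.Order.Filter.AtTopBot.Ring
import HarnessLib

/-!
# Sections of `ζ` beyond `σ = 1`: second-order Euler–Maclaurin for the power sums `∑_{k ≤ m} k^{-s}`

Barrier catalogue `Literature/Barriers/RiemannHypothesis/`, companion of `TuranPartialSums.lean`
(first layer of the "vertical shift" proof of `TuranPartialSums` for large `N`: with the fixed
phases `ω(p) = p^{-iτ}` on the primes `p ≤ √N` in the `σ = 1` criterion `exists_zero_of_criterion`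
of `TuranPartialSumsCriterion.lean`, every quantity of the criterion is a power sum
`S(m) = ∑_{k ≤ m} k^{-s}`, `s = 1 + iτ`, or a sum of such over the free primes). Everything here is
PROVED; nothing is cited beyond the classical Euler–Maclaurin formula.

## Contents (namespace `Literature.Barriers.RiemannHypothesis.TuranShift`)

* `npow s t = exp(−s log t)` — the branch `t^{-s}` on `t > 0` (`= (n : ℂ)^(-s)` at naturals,
  `npow_natCast`), its derivative (`hasDerivAt_npow`) and modulus (`norm_npow`).
* `unit_EM` — the second-order Euler–Maclaurin identity on a unit interval:
  `∫_a^{a+1} f = (f(a) + f(a+1))/2 + ∫_a^{a+1} P₂(t − a) f''(t) dt`, `P₂(x) = (x² − x)/2`, for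
  `f = t^{-s}` (one application of the fundamental theorem of calculus to
  `P₂ f' − (t − a − ½) f`).
* `powSum s m = ∑_{k=1}^{m} k^{-s}`, `powInt s x = ∫_1^x t^{-s} dt` (`= (1 − x^{1−s})/(s−1)`,
  `powInt_eq`), `emJ s k = ∫_k^{k+1} P₂ f''`, `emConst s = ½ − ∑_{k ≥ 1} emJ s k` (the constant
  `c₀(s)`; for `s → 1` it tends to Euler's `γ`, a fact not needed here), `emTail s m = ∑_{k ≥ m} emJ s k`.
* **`powSum_eq_powInt_add`**: for `Re s = 1` and `m ≥ 1`,
  `S(m) = ∫_1^m t^{-s} dt + c₀(s) + m^{-s}/2 + ρ_m` with `‖ρ_m‖ ≤ ‖s(s+1)‖/(16 m²)`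
  (`norm_emTail_le`); in particular the constant is enclosed by any one power sum:
  `‖c₀(s) − (S(K) − ∫_1^K − K^{-s}/2)‖ ≤ ‖s(s+1)‖/(16K²)` (`norm_emConst_sub_le`).
* `norm_powInt_sub_powInt_le` — `‖∫_x^y t^{-s}‖ ≤ log y − log x` (`Re s = 1`).

## References

* Euler–Maclaurin summation to second order with the periodic Bernoulli function `P₂`; e.g.
  H. L. Montgomery, R. C. Vaughan, *Multiplicative Number Theory I*, Thm. B.5 / (1.26). [folklore]
-/

noncomputable section

open Complex MeasureTheory intervalIntegral Set Filter Topology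

namespace Literature.Barriers.RiemannHypothesis

namespace TuranShift

/-! ## The branch `t^{-s} = exp(-s log t)` on the positive reals -/

/-- `npow s t = exp(−s · log t)`: the function `t ↦ t^{-s}` of a REAL variable `t > 0` (real
logarithm), the integrand and summand of everything below. On `t > 0` it coincides with Mathlib's
principal power `(t : ℂ) ^ (-s)` (`npow_eq_cpow`); the explicit `exp ∘ log` form is kept as a
separate name only because every estimate below is a computation with `exp` of a real logarithm
(derivatives in `t`, moduli `t^{-Re s}`, multiplicativity), for which this form avoids the case
distinctions of `cpow` at `t ≤ 0`; all statements transfer to `cpow` through `npow_eq_cpow` /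
`npow_natCast`. [folklore] -/
def npow (s : ℂ) (t : ℝ) : ℂ := Complex.exp (-(s * (Real.log t : ℂ)))

/-- **Bridge to Mathlib**: for every real `t > 0`, `npow s t = (t : ℂ) ^ (-s)`. [folklore] -/
theorem npow_eq_cpow (s : ℂ) {t : ℝ} (ht : 0 < t) : npow s t = (t : ℂ) ^ (-s) := by
  rw [npow, Complex.cpow_def_of_ne_zero (Complex.ofReal_ne_zero.2 ht.ne'), ← Complex.ofReal_log ht.le]
  congr 1
  ring

/-- At a natural number `n ≠ 0`, `npow s n = n^{-s}` (Mathlib's principal power). [folklore] -/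
theorem npow_natCast (s : ℂ) {n : ℕ} (hn : n ≠ 0) : npow s n = (n : ℂ) ^ (-s) := by
  rw [← Complex.ofReal_natCast]
  exact npow_eq_cpow s (by exact_mod_cast Nat.pos_of_ne_zero hn)

/-- `npow s 1 = 1`. [folklore] -/
@[simp] theorem npow_one (s : ℂ) : npow s 1 = 1 := by
  simp [npow]

/-- `‖t^{-s}‖ = t^{-Re s}` for `t > 0`. [folklore] -/
theorem norm_npow (s : ℂ) {t : ℝ} (ht : 0 < t) : ‖npow s t‖ = t ^ (-s.re) := by
  rw [npow, Complex.norm_exp, Real.rpow_def_of_pos ht]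
  congr 1
  simp [Complex.mul_re, Complex.ofReal_re, Complex.ofReal_im]
  ring

/-- `‖t^{-s}‖ = t⁻¹` for `t > 0` when `Re s = 1`. [folklore] -/
theorem norm_npow_of_re_eq_one {s : ℂ} (hs : s.re = 1) {t : ℝ} (ht : 0 < t) :
    ‖npow s t‖ = t⁻¹ := by
  rw [norm_npow s ht, hs, Real.rpow_neg_one]

/-- `npow (s + 1) t = npow s t · t⁻¹` for `t > 0`. [folklore] -/
theorem npow_add_one (s : ℂ) {t : ℝ} (ht : 0 < t) :
    npow (s + 1) t = npow s t * ((t⁻¹ : ℝ) : ℂ) := by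
  have h : ((t⁻¹ : ℝ) : ℂ) = Complex.exp (-(Real.log t : ℂ)) := by
    rw [← Complex.ofReal_neg, ← Complex.ofReal_exp, Real.exp_neg, Real.exp_log ht]
  rw [h, npow, npow, ← Complex.exp_add]
  congr 1
  ring

/-- `d/dt t^{-s} = −s t^{-s-1}` on `t > 0`. [folklore] -/
theorem hasDerivAt_npow (s : ℂ) {t : ℝ} (ht : 0 < t) :
    HasDerivAt (npow s) (-s * npow (s + 1) t) t := by
  have h1 : HasDerivAt (fun x : ℝ ↦ (Real.log x : ℂ)) ((t⁻¹ : ℝ) : ℂ) t :=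
    (Real.hasDerivAt_log ht.ne').ofReal_comp
  have h2 : HasDerivAt (fun x : ℝ ↦ -(s * (Real.log x : ℂ))) (-(s * ((t⁻¹ : ℝ) : ℂ))) t :=
    (h1.const_mul s).neg
  have h3 := h2.cexp
  have h4 : Complex.exp (-(s * (Real.log t : ℂ))) * -(s * ((t⁻¹ : ℝ) : ℂ)) =
      -s * npow (s + 1) t := by
    rw [npow_add_one s ht, npow]
    ring
  rw [← h4]
  exact h3

/-- `t ↦ t^{-s}` is continuous on `(0, ∞)`. [folklore] -/
theorem continuousOn_npow (s : ℂ) : ContinuousOn (npow s) (Ioi 0) := fun _ ht ↦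
  (hasDerivAt_npow s ht).continuousAt.continuousWithinAt

/-- `t ↦ t^{-s}` is continuous on any `[a, b]` with `a > 0`. [folklore] -/
theorem continuousOn_npow_Icc (s : ℂ) {a b : ℝ} (ha : 0 < a) : ContinuousOn (npow s) (Icc a b) :=
  (continuousOn_npow s).mono fun _ ht ↦ lt_of_lt_of_le ha ht.1

/-- Interval integrability of `t^{-s}` on `[a, b]`, `0 < a ≤ b`. [folklore] -/
theorem intervalIntegrable_npow (s : ℂ) {a b : ℝ} (ha : 0 < a) (hab : a ≤ b) :
    IntervalIntegrable (npow s) volume a b :=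
  (continuousOn_npow_Icc s ha (b := b)).intervalIntegrable_of_Icc hab

/-! ## The closed form of `∫ t^{-s}` -/

/-- `∫_x^y t^{-s} dt = (x^{1-s} − y^{1-s})/(s − 1)` for `0 < x ≤ y`, `s ≠ 1`. [folklore] -/
theorem integral_npow_eq {s : ℂ} (hs : s ≠ 1) {x y : ℝ} (hx : 0 < x) (hxy : x ≤ y) :
    ∫ t in x..y, npow s t = (npow (s - 1) x - npow (s - 1) y) / (s - 1) := by
  have hs' : s - 1 ≠ 0 := sub_ne_zero.2 hs
  have hderiv : ∀ t ∈ uIcc x y, HasDerivAt (fun u ↦ -npow (s - 1) u / (s - 1)) (npow s t) t := by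
    intro t ht
    rw [uIcc_of_le hxy] at ht
    have ht0 : 0 < t := lt_of_lt_of_le hx ht.1
    have h := ((hasDerivAt_npow (s - 1) ht0).neg).div_const (s - 1)
    have heq : -(-(s - 1) * npow (s - 1 + 1) t) / (s - 1) = npow s t := by
      rw [sub_add_cancel]
      field_simp
    rwa [heq] at h
  rw [integral_eq_sub_of_hasDerivAt hderiv (intervalIntegrable_npow s hx hxy)]
  field_simp
  ring

/-! ## Second-order Euler–Maclaurin on a unit interval -/

/-- The Bernoulli-type kernel `P₂(x) = (x² − x)/2` on `[0, 1]` (it vanishes at both ends and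
`|P₂| ≤ 1/8`). [folklore] -/
def P2 (x : ℝ) : ℝ := (x ^ 2 - x) / 2

/-- `|P₂(x)| ≤ 1/8` on `[0, 1]`. [folklore] -/
theorem abs_P2_le {x : ℝ} (h0 : 0 ≤ x) (h1 : x ≤ 1) : |P2 x| ≤ 1 / 8 := by
  rw [P2, abs_le]
  constructor <;> nlinarith [sq_nonneg (x - 1 / 2)]

/-- **Second-order Euler–Maclaurin on `[a, a+1]` for `f(t) = t^{-s}`** (`a > 0`):
`∫_a^{a+1} f = (f(a) + f(a+1))/2 + ∫_a^{a+1} P₂(t − a) f''(t) dt`, `f'' = s(s+1) t^{-s-2}`.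
Proof: `d/dt [P₂(t−a) f'(t) − (t−a−½) f(t)] = P₂ f'' − f`. [folklore] -/
theorem unit_EM (s : ℂ) {a : ℝ} (ha : 0 < a) :
    ∫ t in a..(a + 1), npow s t =
      (npow s a + npow s (a + 1)) / 2 +
        ∫ t in a..(a + 1), ((P2 (t - a) : ℝ) : ℂ) * (s * (s + 1) * npow (s + 2) t) := by
  -- the pieces and their derivatives
  set f : ℝ → ℂ := npow s with hf
  set f' : ℝ → ℂ := fun t ↦ -s * npow (s + 1) t with hf'
  set f'' : ℝ → ℂ := fun t ↦ s * (s + 1) * npow (s + 2) t with hf''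
  set Φ : ℝ → ℂ := fun t ↦ ((P2 (t - a) : ℝ) : ℂ) * f' t - (((t - a - 1 / 2 : ℝ)) : ℂ) * f t with hΦ
  have hab : a ≤ a + 1 := by linarith
  have hpos : ∀ t ∈ uIcc a (a + 1), 0 < t := by
    intro t ht; rw [uIcc_of_le hab] at ht; exact lt_of_lt_of_le ha ht.1
  have hderiv : ∀ t ∈ uIcc a (a + 1),
      HasDerivAt Φ (((P2 (t - a) : ℝ) : ℂ) * f'' t - f t) t := by
    intro t ht
    have ht0 := hpos t ht
    have hdf : HasDerivAt f (f' t) t := hasDerivAt_npow s ht0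
    have hdf' : HasDerivAt f' (f'' t) t := by
      have h := (hasDerivAt_npow (s + 1) ht0).const_mul (-s)
      have heq : -s * (-(s + 1) * npow (s + 1 + 1) t) = f'' t := by
        simp only [hf'']
        rw [show s + 1 + 1 = s + 2 by ring]
        ring
      rwa [heq] at h
    have hP : HasDerivAt (fun u : ℝ ↦ ((P2 (u - a) : ℝ) : ℂ)) (((t - a - 1 / 2 : ℝ)) : ℂ) t := by
      have h1 : HasDerivAt (fun u : ℝ ↦ P2 (u - a)) (t - a - 1 / 2) t := by
        have hu : HasDerivAt (fun u : ℝ ↦ u - a) 1 t := (hasDerivAt_id t).sub_const a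
        have h2 : HasDerivAt (fun u : ℝ ↦ (u - a) * (u - a)) (1 * (t - a) + (t - a) * 1) t :=
          hu.mul hu
        have h3 : HasDerivAt (fun u : ℝ ↦ ((u - a) * (u - a) - (u - a)) / 2)
            ((1 * (t - a) + (t - a) * 1 - 1) / 2) t := (h2.sub hu).div_const 2
        have hfun : (fun u : ℝ ↦ P2 (u - a)) = fun u ↦ ((u - a) * (u - a) - (u - a)) / 2 := by
          funext u; simp only [P2, sq]
        rw [hfun, show t - a - 1 / 2 = (1 * (t - a) + (t - a) * 1 - 1) / 2 by ring]
        exact h3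
      exact h1.ofReal_comp
    have hL : HasDerivAt (fun u : ℝ ↦ (((u - a - 1 / 2 : ℝ)) : ℂ)) 1 t := by
      have h1 : HasDerivAt (fun u : ℝ ↦ u - a - 1 / 2) 1 t :=
        ((hasDerivAt_id t).sub_const a).sub_const (1 / 2)
      simpa using h1.ofReal_comp
    have h := (hP.mul hdf').sub (hL.mul hdf)
    have heq : ((t - a - 1 / 2 : ℝ) : ℂ) * f' t + ((P2 (t - a) : ℝ) : ℂ) * f'' t -
        (1 * f t + ((t - a - 1 / 2 : ℝ) : ℂ) * f' t) = ((P2 (t - a) : ℝ) : ℂ) * f'' t - f t := by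
      ring
    rwa [heq] at h
  -- integrability
  have hcf : ContinuousOn f (uIcc a (a + 1)) := by
    rw [uIcc_of_le hab]; exact continuousOn_npow_Icc s ha
  have hcf'' : ContinuousOn f'' (uIcc a (a + 1)) := by
    rw [uIcc_of_le hab]
    exact continuousOn_const.mul (continuousOn_npow_Icc (s + 2) ha)
  have hcP : Continuous (fun t : ℝ ↦ ((P2 (t - a) : ℝ) : ℂ)) := by
    unfold P2; fun_prop
  have hint1 : IntervalIntegrable (fun t ↦ ((P2 (t - a) : ℝ) : ℂ) * f'' t) volume a (a + 1) :=
    (hcP.continuousOn.mul hcf'').intervalIntegrable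
  have hint2 : IntervalIntegrable f volume a (a + 1) := hcf.intervalIntegrable
  have hFTC := integral_eq_sub_of_hasDerivAt hderiv (hint1.sub hint2)
  rw [intervalIntegral.integral_sub hint1 hint2] at hFTC
  -- boundary values of `Φ`
  have hΦa : Φ a = (1 / 2 : ℂ) * f a := by
    simp only [hΦ, sub_self, P2]
    push_cast
    ring
  have hΦb : Φ (a + 1) = -(1 / 2 : ℂ) * f (a + 1) := by
    simp only [hΦ, P2, show a + 1 - a = 1 by ring]
    push_cast
    ring
  rw [hΦa, hΦb] at hFTC
  -- conclude
  have : ∫ t in a..(a + 1), f t = (f a + f (a + 1)) / 2 +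
      ∫ t in a..(a + 1), ((P2 (t - a) : ℝ) : ℂ) * f'' t := by
    linear_combination -hFTC
  simpa [hf, hf''] using this

/-! ## Power sums, the constant `c₀(s)` and the tail -/

/-- `S(m) = ∑_{k=1}^{m} k^{-s}` (as `npow`; equal to `∑ (k : ℂ)^(-s)`, `powSum_eq_sum_cpow`).
[folklore] -/
def powSum (s : ℂ) (m : ℕ) : ℂ := ∑ k ∈ Finset.Icc 1 m, npow s k

/-- `powSum` in terms of Mathlib's complex power. [folklore] -/
theorem powSum_eq_sum_cpow (s : ℂ) (m : ℕ) :
    powSum s m = ∑ k ∈ Finset.Icc 1 m, (k : ℂ) ^ (-s) := by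
  refine Finset.sum_congr rfl fun k hk ↦ ?_
  exact npow_natCast s (by have := (Finset.mem_Icc.1 hk).1; omega)

/-- `S(0) = 0`. [folklore] -/
@[simp] theorem powSum_zero (s : ℂ) : powSum s 0 = 0 := by simp [powSum]

/-- `S(m+1) = S(m) + (m+1)^{-s}`. [folklore] -/
theorem powSum_succ (s : ℂ) (m : ℕ) : powSum s (m + 1) = powSum s m + npow s (m + 1 : ℕ) := by
  rw [powSum, powSum, Finset.sum_Icc_succ_top (by omega)]

/-- `I(x) = ∫_1^x t^{-s} dt`. [folklore] -/
def powInt (s : ℂ) (x : ℝ) : ℂ := ∫ t in (1 : ℝ)..x, npow s t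

/-- Closed form: `I(x) = (1 − x^{1−s})/(s − 1)` for `x ≥ 1`, `s ≠ 1`. [folklore] -/
theorem powInt_eq {s : ℂ} (hs : s ≠ 1) {x : ℝ} (hx : 1 ≤ x) :
    powInt s x = (1 - npow (s - 1) x) / (s - 1) := by
  rw [powInt, integral_npow_eq hs one_pos hx, npow_one]

/-- The Euler–Maclaurin remainder piece `J_k = ∫_k^{k+1} P₂(t − k) f''(t) dt`. [folklore] -/
def emJ (s : ℂ) (k : ℕ) : ℂ :=
  ∫ t in (k : ℝ)..(k + 1), ((P2 (t - k) : ℝ) : ℂ) * (s * (s + 1) * npow (s + 2) t)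

/-- **Euler–Maclaurin, summed**: for `m ≥ 1`,
`∫_1^m t^{-s} dt = S(m) − (1 + m^{-s})/2 + ∑_{1 ≤ k < m} J_k`. [folklore] -/
theorem powInt_nat_eq (s : ℂ) {m : ℕ} (hm : 1 ≤ m) :
    powInt s m = powSum s m - (1 + npow s m) / 2 + ∑ k ∈ Finset.Ico 1 m, emJ s k := by
  induction m, hm using Nat.le_induction with
  | base => simp [powInt, powSum]
  | succ m hm ih =>
    have hm0 : (0 : ℝ) < m := by exact_mod_cast hm
    have hsplit : powInt s (m + 1 : ℕ) = powInt s m + ∫ t in (m : ℝ)..(m + 1), npow s t := by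
      rw [powInt, powInt, Nat.cast_succ]
      rw [integral_add_adjacent_intervals (intervalIntegrable_npow s one_pos (by exact_mod_cast hm))
        (intervalIntegrable_npow s hm0 (by linarith))]
    rw [hsplit, ih, unit_EM s hm0, powSum_succ, Finset.sum_Ico_succ_top hm, emJ]
    push_cast
    ring

/-! ## Bounds for `Re s = 1` -/

/-- `‖J_k‖ ≤ ‖s(s+1)‖ (k^{-2} − (k+1)^{-2})/16` for `k ≥ 1`, `Re s = 1`. [folklore] -/
theorem norm_emJ_le {s : ℂ} (hs : s.re = 1) {k : ℕ} (hk : 1 ≤ k) :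
    ‖emJ s k‖ ≤ ‖s * (s + 1)‖ / 16 * (((k : ℝ) ^ 2)⁻¹ - (((k : ℝ) + 1) ^ 2)⁻¹) := by
  have hk0 : (0 : ℝ) < k := by exact_mod_cast hk
  have hkk : (k : ℝ) ≤ k + 1 := by linarith
  -- pointwise bound by `‖s(s+1)‖/8 · t^{-3}`
  have hbound : ∀ t ∈ Ioc (k : ℝ) (k + 1),
      ‖((P2 (t - k) : ℝ) : ℂ) * (s * (s + 1) * npow (s + 2) t)‖ ≤
        ‖s * (s + 1)‖ / 8 * t ^ (-3 : ℝ) := by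
    intro t ht
    have ht0 : 0 < t := lt_trans hk0 ht.1
    rw [norm_mul, norm_mul, Complex.norm_real, Real.norm_eq_abs, norm_npow (s + 2) ht0]
    have hre : -(s + 2).re = (-3 : ℝ) := by simp [hs]; norm_num
    rw [hre]
    have hP := abs_P2_le (x := t - k) (by linarith [ht.1]) (by linarith [ht.2])
    have h3 : 0 ≤ t ^ (-3 : ℝ) := Real.rpow_nonneg ht0.le _
    have hss : 0 ≤ ‖s * (s + 1)‖ := norm_nonneg _
    calc |P2 (t - k)| * (‖s * (s + 1)‖ * t ^ (-3 : ℝ))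
        ≤ 1 / 8 * (‖s * (s + 1)‖ * t ^ (-3 : ℝ)) :=
          mul_le_mul_of_nonneg_right hP (mul_nonneg hss h3)
      _ = ‖s * (s + 1)‖ / 8 * t ^ (-3 : ℝ) := by ring
  have hint : IntervalIntegrable (fun t : ℝ ↦ ‖s * (s + 1)‖ / 8 * t ^ (-3 : ℝ)) volume k (k + 1) := by
    refine (ContinuousOn.intervalIntegrable ?_)
    rw [uIcc_of_le hkk]
    exact continuousOn_const.mul (continuousOn_id.rpow_const fun t ht ↦
      Or.inl (lt_of_lt_of_le hk0 ht.1).ne')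
  have h1 := norm_integral_le_of_norm_le hkk (Filter.Eventually.of_forall hbound) hint
  rw [emJ]
  refine h1.trans (le_of_eq ?_)
  rw [intervalIntegral.integral_const_mul, integral_rpow (Or.inr ⟨by norm_num, ?_⟩)]
  · have h1' : ((k : ℝ) + 1) ^ ((-3 : ℝ) + 1) = (((k : ℝ) + 1) ^ 2)⁻¹ := by
      rw [show (-3 : ℝ) + 1 = -2 by norm_num, Real.rpow_neg (by linarith), Real.rpow_two]
    have h2' : (k : ℝ) ^ ((-3 : ℝ) + 1) = ((k : ℝ) ^ 2)⁻¹ := by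
      rw [show (-3 : ℝ) + 1 = -2 by norm_num, Real.rpow_neg hk0.le, Real.rpow_two]
    rw [h1', h2']
    ring
  · rw [uIcc_of_le hkk]
    intro h0
    exact absurd h0.1 (not_le.2 hk0)

/-- The majorant `k ↦ ‖s(s+1)‖(k^{-2} − (k+1)^{-2})/16` telescopes: its sum over `k ≥ m` is
`‖s(s+1)‖/(16 m²)` (`m ≥ 1`). [folklore] -/
theorem hasSum_majorant (C : ℝ) {m : ℕ} (hm : 1 ≤ m) :
    HasSum (fun k : ℕ ↦ C * ((((m + k : ℕ) : ℝ) ^ 2)⁻¹ - ((((m + k : ℕ) : ℝ) + 1) ^ 2)⁻¹))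
      (C * (((m : ℝ) ^ 2)⁻¹)) := by
  have key : HasSum (fun k : ℕ ↦ ((((m + k : ℕ) : ℝ) ^ 2)⁻¹ - ((((m + k : ℕ) : ℝ) + 1) ^ 2)⁻¹))
      (((m : ℝ) ^ 2)⁻¹) := by
    have hnn : ∀ k : ℕ, 0 ≤ (((m + k : ℕ) : ℝ) ^ 2)⁻¹ - ((((m + k : ℕ) : ℝ) + 1) ^ 2)⁻¹ := by
      intro k
      have h0 : (0 : ℝ) < ((m + k : ℕ) : ℝ) := by positivity
      rw [sub_nonneg]
      exact inv_anti₀ (by positivity) (by nlinarith)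
    rw [hasSum_iff_tendsto_nat_of_nonneg hnn]
    have htel : ∀ n : ℕ, ∑ i ∈ Finset.range n,
        ((((m + i : ℕ) : ℝ) ^ 2)⁻¹ - ((((m + i : ℕ) : ℝ) + 1) ^ 2)⁻¹) =
          ((m : ℝ) ^ 2)⁻¹ - (((m + n : ℕ) : ℝ) ^ 2)⁻¹ := by
      intro n
      induction n with
      | zero => simp
      | succ n ih =>
        rw [Finset.sum_range_succ, ih]
        push_cast
        ring
    simp_rw [htel]
    have hlim : Tendsto (fun n : ℕ ↦ (((m + n : ℕ) : ℝ) ^ 2)⁻¹) atTop (𝓝 0) := by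
      have h1 : Tendsto (fun n : ℕ ↦ ((m + n : ℕ) : ℝ)) atTop atTop :=
        Filter.tendsto_atTop_mono (fun n ↦ by exact_mod_cast Nat.le_add_left n m)
          tendsto_natCast_atTop_atTop
      exact tendsto_inv_atTop_zero.comp ((tendsto_pow_atTop (by norm_num)).comp h1)
    simpa using tendsto_const_nhds.sub hlim
  exact key.mul_left C

/-- Summability of the remainder pieces from `m ≥ 1` on. [folklore] -/
theorem summable_emJ {s : ℂ} (hs : s.re = 1) {m : ℕ} (hm : 1 ≤ m) :
    Summable (fun k : ℕ ↦ emJ s (m + k)) :=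
  Summable.of_norm_bounded (hasSum_majorant (‖s * (s + 1)‖ / 16) hm).summable
    fun k ↦ norm_emJ_le hs (by omega)

/-- The tail `ρ_m = ∑_{k ≥ m} J_k`. [folklore] -/
def emTail (s : ℂ) (m : ℕ) : ℂ := ∑' k : ℕ, emJ s (m + k)

/-- **`‖ρ_m‖ ≤ ‖s(s+1)‖/(16 m²)`** (`Re s = 1`, `m ≥ 1`). [folklore] -/
theorem norm_emTail_le {s : ℂ} (hs : s.re = 1) {m : ℕ} (hm : 1 ≤ m) :
    ‖emTail s m‖ ≤ ‖s * (s + 1)‖ / (16 * (m : ℝ) ^ 2) := by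
  have hmaj := hasSum_majorant (‖s * (s + 1)‖ / 16) hm
  have h1 : ‖emTail s m‖ ≤ ∑' k : ℕ, ‖emJ s (m + k)‖ :=
    norm_tsum_le_tsum_norm ((hmaj.summable).of_nonneg_of_le (fun _ ↦ norm_nonneg _)
      fun k ↦ norm_emJ_le hs (by omega))
  have h2 : ∑' k : ℕ, ‖emJ s (m + k)‖ ≤ ‖s * (s + 1)‖ / 16 * ((m : ℝ) ^ 2)⁻¹ := by
    rw [← hmaj.tsum_eq]
    exact Summable.tsum_mono ((hmaj.summable).of_nonneg_of_le (fun _ ↦ norm_nonneg _)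
      fun k ↦ norm_emJ_le hs (by omega)) hmaj.summable fun k ↦ norm_emJ_le hs (by omega)
  refine h1.trans (h2.trans (le_of_eq ?_))
  field_simp

/-- The Euler–Maclaurin constant `c₀(s) = ½ − ∑_{k ≥ 1} J_k` (for `s = 1 + iτ`, `τ → 0`, this is
Euler's constant `γ`; only its enclosure `norm_emConst_sub_le` is used downstream). [folklore] -/
def emConst (s : ℂ) : ℂ := 1 / 2 - emTail s 1

/-- The tail from `1` splits as the finite sum below `m` plus the tail from `m`. [folklore] -/
theorem emTail_one_eq {s : ℂ} (hs : s.re = 1) {m : ℕ} (hm : 1 ≤ m) :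
    emTail s 1 = ∑ k ∈ Finset.Ico 1 m, emJ s k + emTail s m := by
  have hsum := summable_emJ hs (le_refl 1)
  have h := (Summable.sum_add_tsum_nat_add (m - 1) hsum).symm
  rw [emTail, emTail, h]
  congr 1
  · rw [Finset.range_eq_Ico]
    have h2 := Finset.sum_Ico_add (fun k ↦ emJ s k) 0 (m - 1) 1
    simp only [zero_add, Nat.sub_add_cancel hm] at h2
    exact h2
  · refine tsum_congr fun k ↦ ?_
    congr 1
    omega

/-- **Second-order Euler–Maclaurin for the power sums**: for `Re s = 1` and `m ≥ 1`,
`S(m) = ∫_1^m t^{-s} dt + c₀(s) + m^{-s}/2 + ρ_m`. [folklore] -/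
theorem powSum_eq_powInt_add {s : ℂ} (hs : s.re = 1) {m : ℕ} (hm : 1 ≤ m) :
    powSum s m = powInt s m + emConst s + npow s m / 2 + emTail s m := by
  rw [powInt_nat_eq s hm, emConst, emTail_one_eq hs hm]
  ring

/-- **Enclosure of the constant by one power sum**: for `Re s = 1` and `K ≥ 1`,
`‖c₀(s) − (S(K) − ∫_1^K t^{-s} − K^{-s}/2)‖ ≤ ‖s(s+1)‖/(16 K²)`. [folklore] -/
theorem norm_emConst_sub_le {s : ℂ} (hs : s.re = 1) {K : ℕ} (hK : 1 ≤ K) :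
    ‖emConst s - (powSum s K - powInt s K - npow s K / 2)‖ ≤ ‖s * (s + 1)‖ / (16 * (K : ℝ) ^ 2) := by
  have h := powSum_eq_powInt_add hs hK
  have : emConst s - (powSum s K - powInt s K - npow s K / 2) = -emTail s K := by
    rw [h]; ring
  rw [this, norm_neg]
  exact norm_emTail_le hs hK

/-- **`‖∫_x^y t^{-s} dt‖ ≤ log y − log x`** for `1 ≤ x ≤ y` (indeed `0 < x`), `Re s = 1`. [folklore] -/
theorem norm_powInt_sub_powInt_le {s : ℂ} (hs : s.re = 1) {x y : ℝ} (hx : 1 ≤ x) (hxy : x ≤ y) :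
    ‖powInt s y - powInt s x‖ ≤ Real.log y - Real.log x := by
  have hx0 : 0 < x := by linarith
  have hsplit : powInt s y - powInt s x = ∫ t in x..y, npow s t := by
    rw [powInt, powInt, ← integral_add_adjacent_intervals (intervalIntegrable_npow s one_pos hx)
      (intervalIntegrable_npow s hx0 hxy)]
    ring
  rw [hsplit]
  have hbound : ∀ t ∈ Ioc x y, ‖npow s t‖ ≤ t⁻¹ := fun t ht ↦
    (norm_npow_of_re_eq_one hs (lt_trans hx0 ht.1)).le
  have hint : IntervalIntegrable (fun t : ℝ ↦ t⁻¹) volume x y := by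
    refine ContinuousOn.intervalIntegrable ?_
    rw [uIcc_of_le hxy]
    exact continuousOn_inv₀.mono fun t ht ↦ (lt_of_lt_of_le hx0 ht.1).ne'
  refine (norm_integral_le_of_norm_le hxy (Filter.Eventually.of_forall hbound) hint).trans ?_
  rw [integral_inv, Real.log_div (by linarith) hx0.ne']
  rw [uIcc_of_le hxy]
  exact fun h ↦ absurd h.1 (not_le.2 hx0)

/-- `‖S(m)‖ ≤ ∑_{k ≤ m} 1/k` (`Re s = 1`), the harmonic number. [folklore] -/
theorem norm_powSum_le {s : ℂ} (hs : s.re = 1) (m : ℕ) :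
    ‖powSum s m‖ ≤ ∑ k ∈ Finset.Icc 1 m, ((k : ℝ))⁻¹ := by
  refine (norm_sum_le _ _).trans (Finset.sum_le_sum fun k hk ↦ ?_)
  have hk0 : (0 : ℝ) < k := by exact_mod_cast (Finset.mem_Icc.1 hk).1
  exact (norm_npow_of_re_eq_one hs hk0).le

/-! ## Multiplicativity and the unimodular case -/

/-- `npow s (a b) = npow s a · npow s b` for `a, b > 0`: `t ↦ t^{-s}` is completely multiplicative on
the positive reals. [folklore] -/
theorem npow_mul (s : ℂ) {a b : ℝ} (ha : 0 < a) (hb : 0 < b) :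
    npow s (a * b) = npow s a * npow s b := by
  rw [npow, npow, npow, Real.log_mul ha.ne' hb.ne', ← Complex.exp_add]
  push_cast
  ring_nf

/-- For a purely imaginary exponent the values are unimodular: `‖t^{-iτ}‖ = 1` (`t > 0`).
[folklore] -/
theorem norm_npow_mul_I (τ : ℝ) {t : ℝ} (ht : 0 < t) : ‖npow (τ * I) t‖ = 1 := by
  rw [norm_npow _ ht]
  simp

/-- `npow (1 + iτ) t = npow (iτ) t · t⁻¹` (`t > 0`): the summands of `S(m)` at `s = 1 + iτ` are the
unimodular phases `k^{-iτ}` divided by `k`. [folklore] -/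
theorem npow_one_add (τ : ℝ) {t : ℝ} (ht : 0 < t) :
    npow (1 + τ * I) t = npow (τ * I) t * ((t⁻¹ : ℝ) : ℂ) := by
  rw [add_comm, npow_add_one _ ht]

end TuranShift

end Literature.Barriers.RiemannHypothesis
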